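import Summits.ValiantsHypothesis.ValiantsHypothesis.Theorems.SymPencilPerFourHessianRankThreeZero

/-!
# Route `SymPencil` — inner rank of the `2 | 2` row split of `per_4`: the mixed side patterns in
# general index position (`--supports` stmt-ValiantsHypothesis-5674 `SdcSuperquadratic`; (8,8) column,
# isotropic-kernel route, bridge step (B1) of memo `NOTE-p6g15-5674-IR12-reduction.md` §8)

General-position versions of `SymPencilPerFourInnerRankSlotTypes.typeI_members / typeII_members`
(there: indices `(2,3 | 0,1)` resp. `3`): for pairwise distinct `c, d, p, q` and a subspace
`W ≤ K⁴ × K⁴` of dimension `≥ 3` satisfying the type-I side pattern (p-side at `c, d`; q-side at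
`p, q, Σ`) the vectors `(a_c e_c + a_d e_d, 0)`, `(a_p e_p - a_q e_q, 0)`, `(0, a_c e_c - a_d e_d)`
lie in `W`; for the type-II pattern (p-side at `d, Σ`; q-side at `p, q, c`) the vectors
`(a_p e_p - a_q e_q, 0)`, `(a_q e_q - a_c e_c, 0)`, `(0, Σ_{j ≠ d} a_j e_j - a_d e_d)` do.  These are
exactly the inputs of `SymPencilPerFourInnerRankMixedKill.false_of_mixedI` and
`SymPencilPerFourInnerRankMixedKillTwo.cols_of_typeII`, with the index data produced by
`SymPencilPerFourInnerRankSlotPattern.pattern_cases`.  Honest framing: linear algebra in a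
conditional reduction of the cells `(8,8,10)`, `(8,8,11)`; nothing about the window, the crux or
`VP ≠ VNP`.  No definitions, no named facts. [folklore]
-/

noncomputable section

-- single-conjunct layout: Sub = Summit, duplicated namespace component intended
set_option linter.dupNamespace false

namespace Summit.ValiantsHypothesis.ValiantsHypothesis.Theorems.SymPencilPerFourInnerRankSlotTypesGen

open Module
open Summit.ValiantsHypothesis.ValiantsHypothesis.Theorems.SymPencilPerFourHessianRankThreeZero

variable {K : Type*} [Field K]

/-- A sum over `Fin 4` written along four pairwise distinct indices. [folklore] -/
theorem sum_four_of_distinct (f : Fin 4 → K) (c d p q : Fin 4) (hcd : c ≠ d) (hcp : c ≠ p)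
    (hcq : c ≠ q) (hdp : d ≠ p) (hdq : d ≠ q) (hpq : p ≠ q) :
    f 0 + f 1 + f 2 + f 3 = f c + f d + f p + f q := by
  revert c d p q
  intro c d p q
  fin_cases c <;> fin_cases d <;> fin_cases p <;> fin_cases q <;> intro hcd hcp hcq hdp hdq hpq <;>
    first | (exfalso; revert hcd hcp hcq hdp hdq hpq; decide) | (simp <;> ring)

/-- **Type I memberships, general position.** [folklore] -/
theorem typeI_members [CharZero K] (a : Fin 4 → K) (ha : ∀ i, a i ≠ 0)
    (W : Submodule K ((Fin 4 → K) × (Fin 4 → K))) (h3 : 3 ≤ finrank K W)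
    (c d p q : Fin 4) (hcd : c ≠ d) (hcp : c ≠ p) (hcq : c ≠ q) (hdp : d ≠ p) (hdq : d ≠ q)
    (hpq : p ≠ q)
    (hPc : ∀ w ∈ W, 2 * (w.1 c / a c) = w.1 0 / a 0 + w.1 1 / a 1 + w.1 2 / a 2 + w.1 3 / a 3)
    (hPd : ∀ w ∈ W, 2 * (w.1 d / a d) = w.1 0 / a 0 + w.1 1 / a 1 + w.1 2 / a 2 + w.1 3 / a 3)
    (hQp : ∀ w ∈ W, 2 * (w.2 p / a p) = w.2 0 / a 0 + w.2 1 / a 1 + w.2 2 / a 2 + w.2 3 / a 3)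
    (hQq : ∀ w ∈ W, 2 * (w.2 q / a q) = w.2 0 / a 0 + w.2 1 / a 1 + w.2 2 / a 2 + w.2 3 / a 3)
    (hQs : ∀ w ∈ W, w.2 0 / a 0 + w.2 1 / a 1 + w.2 2 / a 2 + w.2 3 / a 3 = 0) :
    ((a c • Pi.single c 1 + a d • Pi.single d 1, 0) : (Fin 4 → K) × (Fin 4 → K)) ∈ W ∧
    ((a p • Pi.single p 1 - a q • Pi.single q 1, 0) : (Fin 4 → K) × (Fin 4 → K)) ∈ W ∧
    ((0, a c • Pi.single c 1 - a d • Pi.single d 1) : (Fin 4 → K) × (Fin 4 → K)) ∈ W := by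
  set g₁ : (Fin 4 → K) × (Fin 4 → K) := (a c • Pi.single c 1 + a d • Pi.single d 1, 0) with hg₁
  set g₂ : (Fin 4 → K) × (Fin 4 → K) := (a p • Pi.single p 1 - a q • Pi.single q 1, 0) with hg₂
  set g₃ : (Fin 4 → K) × (Fin 4 → K) := (0, a c • Pi.single c 1 - a d • Pi.single d 1) with hg₃
  set Λ : Submodule K ((Fin 4 → K) × (Fin 4 → K)) := Submodule.span K (Set.range ![g₁, g₂, g₃])
    with hΛ
  have hcov := eq_or_of_four c d p q hcd hcp hcq hdp hdq hpq
  have hle : W ≤ Λ := by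
    intro w hw
    have ec := hPc w hw; have ed := hPd w hw; have fp := hQp w hw; have fq := hQq w hw
    have fs := hQs w hw
    rw [sum_four_of_distinct (fun i => w.1 i / a i) c d p q hcd hcp hcq hdp hdq hpq] at ec ed
    rw [sum_four_of_distinct (fun i => w.2 i / a i) c d p q hcd hcp hcq hdp hdq hpq] at fp fq fs
    obtain ⟨s, hs⟩ : ∃ s : K, s = w.1 c / a c + w.1 d / a d + w.1 p / a p + w.1 q / a q :=
      ⟨_, rfl⟩
    have yq : w.1 q / a q = -(w.1 p / a p) := by linear_combination -hs - ec / 2 - ed / 2 + hs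
    have yc : w.1 c / a c = s / 2 := by linear_combination ec / 2 - hs / 2
    have yd : w.1 d / a d = s / 2 := by linear_combination ed / 2 - hs / 2
    have zp : w.2 p / a p = 0 := by linear_combination fp / 2 + fs / 2
    have zq : w.2 q / a q = 0 := by linear_combination fq / 2 + fs / 2
    have zd : w.2 d / a d = -(w.2 c / a c) := by linear_combination fs - fp / 2 - fq / 2 - fs
    have cc : w.1 c = (s / 2) * a c := by rw [← yc]; field_simp [ha c]
    have cd' : w.1 d = (s / 2) * a d := by rw [← yd]; field_simp [ha d]
    have cp : w.1 p = (w.1 p / a p) * a p := by field_simp [ha p]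
    have cq : w.1 q = -(w.1 p / a p) * a q := by rw [← yq]; field_simp [ha q]
    have dp : w.2 p = 0 := by
      have h := zp; rwa [div_eq_zero_iff, or_iff_left (ha p)] at h
    have dq : w.2 q = 0 := by
      have h := zq; rwa [div_eq_zero_iff, or_iff_left (ha q)] at h
    have dc : w.2 c = (w.2 c / a c) * a c := by field_simp [ha c]
    have dd : w.2 d = -(w.2 c / a c) * a d := by rw [← zd]; field_simp [ha d]
    have hw_eq : w = (s / 2) • g₁ + (w.1 p / a p) • g₂ + (w.2 c / a c) • g₃ := by
      refine Prod.ext (funext fun i => ?_) (funext fun i => ?_) <;>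
        rcases hcov i with rfl | rfl | rfl | rfl <;>
        simp [hg₁, hg₂, hg₃, hcd, hcp, hcq, hdp, hdq, hpq, hcd.symm, hcp.symm,
          hcq.symm, hdp.symm, hdq.symm, hpq.symm] <;>
        first
          | linear_combination cc | linear_combination cd' | linear_combination cp
          | linear_combination cq | linear_combination dp | linear_combination dq
          | linear_combination dc | linear_combination dd
    rw [hw_eq]
    refine Submodule.add_mem _ (Submodule.add_mem _ (Submodule.smul_mem _ _ ?_)
      (Submodule.smul_mem _ _ ?_)) (Submodule.smul_mem _ _ ?_)
    · exact Submodule.subset_span ⟨0, rfl⟩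
    · exact Submodule.subset_span ⟨1, rfl⟩
    · exact Submodule.subset_span ⟨2, rfl⟩
  have hfin : finrank K Λ ≤ 3 := by
    have h := finrank_range_le_card (R := K) ![g₁, g₂, g₃]
    rwa [Fintype.card_fin] at h
  have heq : W = Λ := Submodule.eq_of_le_of_finrank_le hle (hfin.trans h3)
  refine ⟨?_, ?_, ?_⟩
  · rw [heq]; exact Submodule.subset_span ⟨0, rfl⟩
  · rw [heq]; exact Submodule.subset_span ⟨1, rfl⟩
  · rw [heq]; exact Submodule.subset_span ⟨2, rfl⟩

/-- **Type II memberships, general position** (p-side at `d, Σ`; q-side at `p, q, c`).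
[folklore] -/
theorem typeII_members [CharZero K] (a : Fin 4 → K) (ha : ∀ i, a i ≠ 0)
    (W : Submodule K ((Fin 4 → K) × (Fin 4 → K))) (h3 : 3 ≤ finrank K W)
    (d p q c : Fin 4) (hdp : d ≠ p) (hdq : d ≠ q) (hdc : d ≠ c) (hpq : p ≠ q) (hpc : p ≠ c)
    (hqc : q ≠ c)
    (hPd : ∀ w ∈ W, 2 * (w.1 d / a d) = w.1 0 / a 0 + w.1 1 / a 1 + w.1 2 / a 2 + w.1 3 / a 3)
    (hPs : ∀ w ∈ W, w.1 0 / a 0 + w.1 1 / a 1 + w.1 2 / a 2 + w.1 3 / a 3 = 0)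
    (hQp : ∀ w ∈ W, 2 * (w.2 p / a p) = w.2 0 / a 0 + w.2 1 / a 1 + w.2 2 / a 2 + w.2 3 / a 3)
    (hQq : ∀ w ∈ W, 2 * (w.2 q / a q) = w.2 0 / a 0 + w.2 1 / a 1 + w.2 2 / a 2 + w.2 3 / a 3)
    (hQc : ∀ w ∈ W, 2 * (w.2 c / a c) = w.2 0 / a 0 + w.2 1 / a 1 + w.2 2 / a 2 + w.2 3 / a 3) :
    ((a p • Pi.single p 1 - a q • Pi.single q 1, 0) : (Fin 4 → K) × (Fin 4 → K)) ∈ W ∧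
    ((a q • Pi.single q 1 - a c • Pi.single c 1, 0) : (Fin 4 → K) × (Fin 4 → K)) ∈ W ∧
    ((0, a p • Pi.single p 1 + a q • Pi.single q 1 + a c • Pi.single c 1 - a d • Pi.single d 1) :
      (Fin 4 → K) × (Fin 4 → K)) ∈ W := by
  set g₁ : (Fin 4 → K) × (Fin 4 → K) := (a p • Pi.single p 1 - a q • Pi.single q 1, 0) with hg₁
  set g₂ : (Fin 4 → K) × (Fin 4 → K) := (a q • Pi.single q 1 - a c • Pi.single c 1, 0) with hg₂
  set g₃ : (Fin 4 → K) × (Fin 4 → K) :=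
    (0, a p • Pi.single p 1 + a q • Pi.single q 1 + a c • Pi.single c 1 - a d • Pi.single d 1)
    with hg₃
  set Λ : Submodule K ((Fin 4 → K) × (Fin 4 → K)) := Submodule.span K (Set.range ![g₁, g₂, g₃])
    with hΛ
  have hcov := eq_or_of_four d p q c hdp hdq hdc hpq hpc hqc
  have hle : W ≤ Λ := by
    intro w hw
    have ed := hPd w hw; have es := hPs w hw; have fp := hQp w hw; have fq := hQq w hw
    have fc := hQc w hw
    rw [sum_four_of_distinct (fun i => w.1 i / a i) d p q c hdp hdq hdc hpq hpc hqc] at ed es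
    rw [sum_four_of_distinct (fun i => w.2 i / a i) d p q c hdp hdq hdc hpq hpc hqc] at fp fq fc
    have yd : w.1 d / a d = 0 := by linear_combination ed / 2 + es / 2
    have yc : w.1 c / a c = -(w.1 p / a p) - w.1 q / a q := by linear_combination es - ed / 2 - es / 2
    have zq : w.2 q / a q = w.2 p / a p := by linear_combination fq / 2 - fp / 2
    have zc : w.2 c / a c = w.2 p / a p := by linear_combination fc / 2 - fp / 2
    have zd : w.2 d / a d = -(w.2 p / a p) := by linear_combination -fq / 2 - fc / 2
    have cp : w.1 p = (w.1 p / a p) * a p := by field_simp [ha p]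
    have cq : w.1 q = (w.1 q / a q) * a q := by field_simp [ha q]
    have cc : w.1 c = (-(w.1 p / a p) - w.1 q / a q) * a c := by rw [← yc]; field_simp [ha c]
    have cdd : w.1 d = 0 := by
      have h := yd; rwa [div_eq_zero_iff, or_iff_left (ha d)] at h
    have dp : w.2 p = (w.2 p / a p) * a p := by field_simp [ha p]
    have dq : w.2 q = (w.2 p / a p) * a q := by rw [← zq]; field_simp [ha q]
    have dc : w.2 c = (w.2 p / a p) * a c := by rw [← zc]; field_simp [ha c]
    have dd : w.2 d = -(w.2 p / a p) * a d := by rw [← zd]; field_simp [ha d]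
    have hw_eq : w = (w.1 p / a p) • g₁ + (w.1 p / a p + w.1 q / a q) • g₂ + (w.2 p / a p) • g₃ := by
      refine Prod.ext (funext fun i => ?_) (funext fun i => ?_) <;>
        rcases hcov i with rfl | rfl | rfl | rfl <;>
        simp [hg₁, hg₂, hg₃, hdp, hdq, hdc, hpq, hpc, hqc, hdp.symm, hdq.symm, hdc.symm,
          hpq.symm, hpc.symm, hqc.symm] <;>
        first
          | linear_combination cp | linear_combination cq | linear_combination cc
          | linear_combination cdd | linear_combination dp | linear_combination dq
          | linear_combination dc | linear_combination dd
    rw [hw_eq]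
    refine Submodule.add_mem _ (Submodule.add_mem _ (Submodule.smul_mem _ _ ?_)
      (Submodule.smul_mem _ _ ?_)) (Submodule.smul_mem _ _ ?_)
    · exact Submodule.subset_span ⟨0, rfl⟩
    · exact Submodule.subset_span ⟨1, rfl⟩
    · exact Submodule.subset_span ⟨2, rfl⟩
  have hfin : finrank K Λ ≤ 3 := by
    have h := finrank_range_le_card (R := K) ![g₁, g₂, g₃]
    rwa [Fintype.card_fin] at h
  have heq : W = Λ := Submodule.eq_of_le_of_finrank_le hle (hfin.trans h3)
  refine ⟨?_, ?_, ?_⟩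
  · rw [heq]; exact Submodule.subset_span ⟨0, rfl⟩
  · rw [heq]; exact Submodule.subset_span ⟨1, rfl⟩
  · rw [heq]; exact Submodule.subset_span ⟨2, rfl⟩

end Summit.ValiantsHypothesis.ValiantsHypothesis.Theorems.SymPencilPerFourInnerRankSlotTypesGen

end
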